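import Literature.MathematicalPhysics.QuantumFieldTheory.Balaban1983to89.B9Eq3132CoerciveFromEnergyR
import Literature.MathematicalPhysics.QuantumFieldTheory.Balaban1983to89.Node00.OpsYSectDQ

/-!
# BalabanUVNodes ∕ N06 ([B9], `Dag.B9_main`) — ROW 26 AT THE KNIT PAIR, PIECE 3: THE ROW-26 COERCIVITY BINDER `hcoA` FOR `𝔮 (Δ⁻¹) 𝔮⋆` FROM THE DISPLAYED SYMMETRY ∕
# POSITIVITY OF `Δ` AND A TEST FAMILY — letter-generic (any trace-adjoint pair `𝔮 ∕ 𝔮⋆`, any `Δ`), over the class-parametric carrier `bg9YR … G R₁ R₂`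

Track A of `YM-PLAN.md` (cell `pub-ymgap`, HUMAN RULING D-0062), node **N06** = [Balaban1985BackgroundPropagators]; piece 3 of «P-Q26-knit» (KA's displayed `s3132K`; seat
`pub-ymgap-dag-n06-l` g37, 2026-08-30).  dag-n06-i's `B9Eq3132CoerciveFromEnergyR.hcoA_of_testFamily_R` re-pressed with the straight pair `QY ∕ QsY (parBY)` and `Δ_a(U; parSymY, parBY)`
replaced by PARAMETERS: letter families `𝔮 x U`, `𝔮⋆ x U` trace-adjoint at every configuration of the carrier's class (`hadj` — at the knit pair of record `isAdjTr_adjTrY`, at the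
straight pair `isAdjTr_QY_QsY_parBY`), a form family `Δ x U` whose trace-symmetry AND positivity are DISPLAYED together (`hΔ` — the knit certificate KA's row-17 binder `hΔAK`
VERBATIM species: `IsSymmTr 1 (Δ_a^Q(U)) ∧ PosDefTr 1 (Δ_a^Q(U))`), and the letter `T₀ x U = Ring.inverse (Δ x U)`.  The one-configuration variational principle is n06-i's
`coercive_normMatY_of_testOp` BY NAME (already letter-generic).  HONEST FRAMING: composition of landed theorems; the test family with (P′2)∕(P′1) and `hΔ` are HYPOTHESES;
nothing of [B9] ∕ [4] asserted; COUNT-NEUTRAL; N06 NOT discharged; nothing continuum ∕ OS ∕ mass gap ∕ Clay.  0 `def`, 0 `sorry`.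
[cite: Balaban1984PropagatorsII, (2.147) p.249; Balaban1985BackgroundPropagators, (3.132) p.422, Thm 3.11 p.416, Thm 3.12 p.423 (prefix), (3.13) p.393, (3.115) p.418]
-/

noncomputable section

namespace Summit.QuantumFields.YangMills.BalabanUVNodes.N06Eq3132CoerciveVariationalQ

open scoped Matrix.Norms.L2Operator
open Literature.MathematicalPhysics.QuantumFieldTheory.Balaban1983to89
open Literature.MathematicalPhysics.QuantumFieldTheory.Balaban1983to89.Node00
open Literature.MathematicalPhysics.QuantumFieldTheory.Balaban1983to89.B6KLevelCensusIndexV1 (KIdx)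
open Literature.MathematicalPhysics.QuantumFieldTheory.Balaban1983to89.B9PinMembersKLevelV1 (MemberY geo9Y bg9Y)
open Literature.MathematicalPhysics.QuantumFieldTheory.Balaban1983to89.B9BackgroundsKLevelV1R (RegFamY bg9YR)
open Literature.MathematicalPhysics.QuantumFieldTheory.Balaban1983to89.B9Thm311ReadingCoords (trIP PosDefTr IsSymmTr IsAdjTr)
open Literature.MathematicalPhysics.QuantumFieldTheory.Balaban1983to89.B9CoReadingCoordsTranspose (TrIdx trBasis trBasis_repr_eq_trace)
open Literature.MathematicalPhysics.QuantumFieldTheory.Balaban1983to89.B9Eq3132RingInverseReading (normMatY dimConstY' dimConstY'_pos)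
open Literature.MathematicalPhysics.QuantumFieldTheory.Balaban1983to89.B9Eq3132NuReading (lamInvY)
open Literature.MathematicalPhysics.QuantumFieldTheory.Balaban1983to89.B9Eq3132CTInputs (CoerciveUnder)
open Literature.MathematicalPhysics.QuantumFieldTheory.Balaban1983to89.B9Eq3132ScalarIndex (geoComap)
open Literature.MathematicalPhysics.QuantumFieldTheory.Balaban1983to89.B9Eq3132CoerciveVariational (coercive_normMatY_of_testOp)

variable {N : ℕ}

section TestFamily

variable {d ℓ : ℕ} {hd : 1 ≤ d + 1} {hL : Odd (ℓ + 1) ∧ 1 < ℓ + 1} {b₀ b₁ : ℝ} (Mstar : ℕ) {G : Subgroup (Matrix (Fin N) (Fin N) ℂ)ˣ}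
variable (R₁ R₂ : RegFamY d ℓ hd hL b₀ b₁ Mstar (Matrix (Fin N) (Fin N) ℂ))

/-- ★★ **THE ROW-26 COERCIVITY BINDER `hcoA` FOR `𝔮 (Δ⁻¹) 𝔮⋆` FROM A TEST FAMILY, LETTER-GENERIC, AT THE CLASS-PARAMETRIC CARRIER**: letter families `𝔮 ∕ 𝔮⋆` trace-adjoint on the
carrier's (3.35) (`hadj`); a form family `Δ` trace-symmetric and positive definite under ROW 17's prefix (`hΔ`, displayed — KA's `hΔAK` species); `T₀ x U = Ring.inverse (Δ x U)`; a test
family `T` with (P′2) `(1−ϑ)‖Ψ‖² ≤ Re tr⟨𝔮(U)(TΨ), Λ⁻¹Ψ⟩` and (P′1) `Re tr⟨TΨ, Δ(U)(TΨ)⟩ ≤ C‖Ψ‖²` under Thm 3.12's prefix with uniform `ϑ < 1`, `C > 0`.  THEN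
`CoerciveUnder c35 geo (bg9YR … R₁ R₂) (fun x U => normMatY (trBasis N) Λ⁻¹ (QGQOfQY x.toKIdx (𝔮 x) (𝔮⋆ x) (T₀ x) U))` with constant `(1−ϑ)²∕(C·κ′)`.
[cite: Balaban1984PropagatorsII, (2.147) p.249; Balaban1985BackgroundPropagators, (3.132) p.422, Thm 3.11 p.416, Thm 3.12 p.423 (prefix), (3.13) p.393] -/
theorem hcoA_of_testFamily_QR
    [∀ x : MemberY d ℓ hd hL b₀ b₁ Mstar, Fintype (geo9Y x).Site]
    [∀ x : MemberY d ℓ hd hL b₀ b₁ Mstar, DecidableEq (geo9Y x).Site] {c35 : ℝ}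
    (𝔮 : ∀ x : MemberY d ℓ hd hL b₀ b₁ Mstar, CfgY (Matrix (Fin N) (Fin N) ℂ) x.toKIdx →
      ((FBondY x.toKIdx → Matrix (Fin N) (Fin N) ℂ) →ₗ[ℂ] (IBondY x.toKIdx → Matrix (Fin N) (Fin N) ℂ)))
    (𝔮s : ∀ x : MemberY d ℓ hd hL b₀ b₁ Mstar, CfgY (Matrix (Fin N) (Fin N) ℂ) x.toKIdx →
      ((IBondY x.toKIdx → Matrix (Fin N) (Fin N) ℂ) →ₗ[ℂ] (FBondY x.toKIdx → Matrix (Fin N) (Fin N) ℂ)))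
    (Δ : ∀ x : MemberY d ℓ hd hL b₀ b₁ Mstar, CfgY (Matrix (Fin N) (Fin N) ℂ) x.toKIdx →
      ((FBondY x.toKIdx → Matrix (Fin N) (Fin N) ℂ) →ₗ[ℂ] (FBondY x.toKIdx → Matrix (Fin N) (Fin N) ℂ)))
    (T₀ : ∀ x : MemberY d ℓ hd hL b₀ b₁ Mstar, BondOpY (Matrix (Fin N) (Fin N) ℂ) x.toKIdx)
    (hT₀ : ∀ (x : MemberY d ℓ hd hL b₀ b₁ Mstar) (U : CfgY (Matrix (Fin N) (Fin N) ℂ) x.toKIdx), T₀ x U = Ring.inverse (Δ x U))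
    (hadj : ∀ (x : MemberY d ℓ hd hL b₀ b₁ Mstar) (α₀ : ℝ) (U : (bg9YR (Matrix (Fin N) (Fin N) ℂ) G R₁ R₂ x).Cfg),
      (bg9YR (Matrix (Fin N) (Fin N) ℂ) G R₁ R₂ x).Reg335 c35 α₀ U → IsAdjTr (fun _ => (1 : ℝ)) (fun _ => (1 : ℝ)) (𝔮 x U) (𝔮s x U))
    (a311 M311 : ℝ) (ha311 : 0 < a311) (hM311 : 0 < M311)
    (hΔ : ∀ x : MemberY d ℓ hd hL b₀ b₁ Mstar, M311 ≤ (geo9Y x).M → ∀ α₀ : ℝ, 0 < α₀ → (geo9Y x).M * α₀ ≤ a311 →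
      ∀ U : (bg9YR (Matrix (Fin N) (Fin N) ℂ) G R₁ R₂ x).Cfg, (bg9YR (Matrix (Fin N) (Fin N) ℂ) G R₁ R₂ x).Reg335 c35 α₀ U →
        IsSymmTr (fun _ => (1 : ℝ)) (Δ x U) ∧ PosDefTr (fun _ => (1 : ℝ)) (Δ x U))
    (T : ∀ x : MemberY d ℓ hd hL b₀ b₁ Mstar, CfgY (Matrix (Fin N) (Fin N) ℂ) x.toKIdx →
      (IBondY x.toKIdx → Matrix (Fin N) (Fin N) ℂ) → (FBondY x.toKIdx → Matrix (Fin N) (Fin N) ℂ))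
    (hT : ∃ Mt aT ϑ C : ℝ, 0 < Mt ∧ 0 < aT ∧ ϑ < 1 ∧ 0 < C ∧
      ∀ x : MemberY d ℓ hd hL b₀ b₁ Mstar, Mt ≤ (geo9Y x).M → ∀ α₀ : ℝ, 0 < α₀ → (geo9Y x).M * α₀ ≤ aT →
        ∀ U : (bg9YR (Matrix (Fin N) (Fin N) ℂ) G R₁ R₂ x).Cfg,
          (bg9YR (Matrix (Fin N) (Fin N) ℂ) G R₁ R₂ x).Reg335 c35 α₀ U → (bg9YR (Matrix (Fin N) (Fin N) ℂ) G R₁ R₂ x).Reg336 c35 α₀ U →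
            (∀ Ψ : IBondY x.toKIdx → Matrix (Fin N) (Fin N) ℂ,
              (1 - ϑ) * trIP (fun _ => (1 : ℝ)) Ψ Ψ ≤ trIP (fun _ => (1 : ℝ)) (𝔮 x U (T x U Ψ)) (fun y => lamInvY x.toKIdx y • Ψ y)) ∧
            (∀ Ψ : IBondY x.toKIdx → Matrix (Fin N) (Fin N) ℂ,
              trIP (fun _ => (1 : ℝ)) (T x U Ψ) (Δ x U (T x U Ψ)) ≤ C * trIP (fun _ => (1 : ℝ)) Ψ Ψ)) :
    CoerciveUnder c35
      (fun x : MemberY d ℓ hd hL b₀ b₁ Mstar => geoComap (geo9Y x) (Prod.fst : (geo9Y x).Site × TrIdx N → (geo9Y x).Site))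
      (bg9YR (Matrix (Fin N) (Fin N) ℂ) G R₁ R₂)
      (fun x U => normMatY (trBasis N) (lamInvY x.toKIdx) (QGQOfQY x.toKIdx (𝔮 x) (𝔮s x) (T₀ x) U)) := by
  have hT₀' : T₀ = fun (x : MemberY d ℓ hd hL b₀ b₁ Mstar) (U : CfgY (Matrix (Fin N) (Fin N) ℂ) x.toKIdx) => Ring.inverse (Δ x U) :=
    funext fun x => funext fun U => hT₀ x U
  subst hT₀'
  obtain ⟨Mt, aT, ϑ, C, hMt, hat, hϑ, hC, hT⟩ := hT
  refine ⟨max M311 Mt, min a311 aT, (1 - ϑ) ^ 2 / (C * dimConstY' (trBasis N)), lt_of_lt_of_le hM311 (le_max_left _ _), lt_min ha311 hat,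
    div_pos (by nlinarith) (mul_pos hC (dimConstY'_pos _)), fun x hM α₀ hα₀ hMa U hU hU' => ?_⟩
  obtain ⟨hsymm, hpos⟩ := hΔ x ((le_max_left _ _).trans hM) α₀ hα₀ (hMa.trans (min_le_left _ _)) U hU
  obtain ⟨hP2, hP1⟩ := hT x ((le_max_right _ _).trans hM) α₀ hα₀ (hMa.trans (min_le_right _ _)) U hU hU'
  have key := coercive_normMatY_of_testOp (trBasis N) (trBasis_repr_eq_trace N) _ hsymm hpos _ _ (hadj x α₀ U hU) (lamInvY x.toKIdx) (T x U)
    hϑ.le hC hP2 hP1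
  -- the goal reads the index bonds as `(geo9Y x).Site` with the family's `Fintype ∕ DecidableEq` instances, `key` with the global ones (equal by
  -- `Subsingleton.elim`, which `convert` discharges); `QGQOfQY` IS the composite `𝔮 ∘ T₀ ∘ 𝔮⋆` by `rfl`
  beta_reduce
  convert key using 3
  all_goals rfl

end TestFamily

end Summit.QuantumFields.YangMills.BalabanUVNodes.N06Eq3132CoerciveVariationalQ

end
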